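import Summits.BirchSwinnertonDyer.BirchSwinnertonDyer.Theorems.Rank2Observatory2DescClFieldCertQ2Reg
import HarnessLib

/-!
# BirchSwinnertonDyer — rank ≥ 2 observatory: KERNEL-2DESC-CL E2Q2 — the four auxiliary primes of a two-prime field record from its registry core, part 2/8

HONEST FRAMING: per-curve certified theorems and census instruments; no claim on BSD in rank ≥ 2.

Continuation of part 1 (`…2DescClFieldCertQ2Reg`, split at the 400-line module cap; text verbatim): from the
registry core `ClFieldCertQ2.checkReg` alone, the four primes `W₁₁r W₁₂r` (above `q₁ = W₁₁W₁₂`) and `W₂₁r W₂₂r`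
(above `q₂`) as height-one primes with their norms, covers and distinctness, the prime of a certified registry
code (`codePrimeR`), and the generic valuation computations `log_q₁r`, `log_q₂r`, `log_W₁₁r_of_not_mem`,
`log_W₂₁r_of_not_mem` used by the two-view family layer (parts 6–7).  Q2 proofs verbatim with `check ↦ checkReg`.
Sorry-free; new declarations only; axioms `propext`, `Classical.choice`, `Quot.sound`.
[cite: Cohen1993, §4.8.2, §6.2] [cite: Marcus2018, Ch. 3, Thm. 22 and Thm. 27] [cite: Cassels1991LecturesEllipticCurves, §15]
-/

set_option linter.dupNamespace false

noncomputable section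

open scoped Classical NumberField nonZeroDivisors

open Literature.NumberTheory.NumberFields Polynomial Module NumberField IsDedekindDomain Ideal

namespace Summit.BirchSwinnertonDyer.BirchSwinnertonDyer.Rank2Observatory.TwoDescCl

open TwoDescCubic

variable {K : Type*} [Field K] [NumberField K] {θ : K} (fc : ClFieldCertQ2)

namespace ClFieldCertQ2


/-! ### The four auxiliary primes as height-one primes -/

/-- **`W₁₁r`** as a height-one prime (registry core). -/
def W₁₁r (hθ : aeval θ (MonicCubic.poly fc.a fc.b fc.c) = 0) (h3 : finrank ℚ K = 3) (hR : fc.checkReg = true)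
    (hpr : fc.primeList.Forall Nat.Prime) : HeightOneSpectrum (𝓞 K) :=
  primeOfCode (fc.irreducible_of_reg hR) hθ h3 (e := fc.qEntry₁) (fc.q₁_prime hpr) (fc.qEntry₁_check_reg hR)
    fc.w₁₁_mem_codes

/-- **`W₁₂r`** as a height-one prime (registry core). -/
def W₁₂r (hθ : aeval θ (MonicCubic.poly fc.a fc.b fc.c) = 0) (h3 : finrank ℚ K = 3) (hR : fc.checkReg = true)
    (hpr : fc.primeList.Forall Nat.Prime) : HeightOneSpectrum (𝓞 K) :=
  primeOfCode (fc.irreducible_of_reg hR) hθ h3 (e := fc.qEntry₁) (fc.q₁_prime hpr) (fc.qEntry₁_check_reg hR)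
    fc.w₁₂_mem_codes

/-- **`W₂₁r`** as a height-one prime (registry core). -/
def W₂₁r (hθ : aeval θ (MonicCubic.poly fc.a fc.b fc.c) = 0) (h3 : finrank ℚ K = 3) (hR : fc.checkReg = true)
    (hpr : fc.primeList.Forall Nat.Prime) : HeightOneSpectrum (𝓞 K) :=
  primeOfCode (fc.irreducible_of_reg hR) hθ h3 (e := fc.qEntry₂) (fc.q₂_prime hpr) (fc.qEntry₂_check_reg hR)
    fc.w₂₁_mem_codes

/-- **`W₂₂r`** as a height-one prime (registry core). -/
def W₂₂r (hθ : aeval θ (MonicCubic.poly fc.a fc.b fc.c) = 0) (h3 : finrank ℚ K = 3) (hR : fc.checkReg = true)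
    (hpr : fc.primeList.Forall Nat.Prime) : HeightOneSpectrum (𝓞 K) :=
  primeOfCode (fc.irreducible_of_reg hR) hθ h3 (e := fc.qEntry₂) (fc.q₂_prime hpr) (fc.qEntry₂_check_reg hR)
    fc.w₂₂_mem_codes

variable {fc}

section W
variable (hθ : aeval θ (MonicCubic.poly fc.a fc.b fc.c) = 0) (h3 : finrank ℚ K = 3) (hR : fc.checkReg = true)
  (hpr : fc.primeList.Forall Nat.Prime)

/-- `W₁₁r` is presented by its code. -/
theorem W₁₁r_asIdeal : (fc.W₁₁r hθ h3 hR hpr).asIdeal = idealOf hθ fc.w₁₁ := rfl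

/-- `W₁₂r` is presented by its code. -/
theorem W₁₂r_asIdeal : (fc.W₁₂r hθ h3 hR hpr).asIdeal = idealOf hθ fc.w₁₂ := rfl

/-- `W₂₁r` is presented by its code. -/
theorem W₂₁r_asIdeal : (fc.W₂₁r hθ h3 hR hpr).asIdeal = idealOf hθ fc.w₂₁ := rfl

/-- `W₂₂r` is presented by its code. -/
theorem W₂₂r_asIdeal : (fc.W₂₂r hθ h3 hR hpr).asIdeal = idealOf hθ fc.w₂₂ := rfl

/-- `W₁₁r ≠ W₁₂r`. -/
theorem W₁₁r_ne_W₁₂r : fc.W₁₁r hθ h3 hR hpr ≠ fc.W₁₂r hθ h3 hR hpr := fun h =>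
  fc.w₁₁_ne_w₁₂_reg hθ h3 hR hpr (congrArg HeightOneSpectrum.asIdeal h)

/-- `W₂₁r ≠ W₂₂r`. -/
theorem W₂₁r_ne_W₂₂r : fc.W₂₁r hθ h3 hR hpr ≠ fc.W₂₂r hθ h3 hR hpr := fun h =>
  fc.w₂₁_ne_w₂₂_reg hθ h3 hR hpr (congrArg HeightOneSpectrum.asIdeal h)

/-- `N(W₁₁r) = q₁`. -/
theorem absNorm_W₁₁r : absNorm (fc.W₁₁r hθ h3 hR hpr).asIdeal = fc.q₁ := (fc.w₁₁_of_reg hθ h3 hR hpr).2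

/-- `N(W₁₂r) = q₁²`. -/
theorem absNorm_W₁₂r : absNorm (fc.W₁₂r hθ h3 hR hpr).asIdeal = fc.q₁ ^ 2 := (fc.w₁₂_of_reg hθ h3 hR hpr).2

/-- `N(W₂₁r) = q₂`. -/
theorem absNorm_W₂₁r : absNorm (fc.W₂₁r hθ h3 hR hpr).asIdeal = fc.q₂ := (fc.w₂₁_of_reg hθ h3 hR hpr).2

/-- `N(W₂₂r) = q₂²`. -/
theorem absNorm_W₂₂r : absNorm (fc.W₂₂r hθ h3 hR hpr).asIdeal = fc.q₂ ^ 2 := (fc.w₂₂_of_reg hθ h3 hR hpr).2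

/-- `q₁ ∈ W₁₁r`. -/
theorem q₁_mem_W₁₁r : ((fc.q₁ : ℕ) : 𝓞 K) ∈ (fc.W₁₁r hθ h3 hR hpr).asIdeal :=
  natCast_mem_idealOf hθ (e := fc.qEntry₁) fc.w₁₁_mem_codes

/-- `q₁ ∈ W₁₂r`. -/
theorem q₁_mem_W₁₂r : ((fc.q₁ : ℕ) : 𝓞 K) ∈ (fc.W₁₂r hθ h3 hR hpr).asIdeal :=
  natCast_mem_idealOf hθ (e := fc.qEntry₁) fc.w₁₂_mem_codes

/-- `q₂ ∈ W₂₁r`. -/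
theorem q₂_mem_W₂₁r : ((fc.q₂ : ℕ) : 𝓞 K) ∈ (fc.W₂₁r hθ h3 hR hpr).asIdeal :=
  natCast_mem_idealOf hθ (e := fc.qEntry₂) fc.w₂₁_mem_codes

/-- `q₂ ∈ W₂₂r`. -/
theorem q₂_mem_W₂₂r : ((fc.q₂ : ℕ) : 𝓞 K) ∈ (fc.W₂₂r hθ h3 hR hpr).asIdeal :=
  natCast_mem_idealOf hθ (e := fc.qEntry₂) fc.w₂₂_mem_codes

/-- Every height-one prime containing `q₁` is `W₁₁r` or `W₁₂r`. [cite: Cohen1993, §4.8.2, Thm. 4.8.13] -/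
theorem eq_W₁₁r_or_W₁₂r (u : HeightOneSpectrum (𝓞 K)) (hu : ((fc.q₁ : ℕ) : 𝓞 K) ∈ u.asIdeal) :
    u = fc.W₁₁r hθ h3 hR hpr ∨ u = fc.W₁₂r hθ h3 hR hpr := by
  rcases fc.qcover₁_of_reg hθ h3 hR hpr u.asIdeal u.isPrime hu with h | h
  · exact Or.inl (HeightOneSpectrum.ext h)
  · exact Or.inr (HeightOneSpectrum.ext h)

/-- Every height-one prime containing `q₂` is `W₂₁r` or `W₂₂r`. [cite: Cohen1993, §4.8.2, Thm. 4.8.13] -/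
theorem eq_W₂₁r_or_W₂₂r (u : HeightOneSpectrum (𝓞 K)) (hu : ((fc.q₂ : ℕ) : 𝓞 K) ∈ u.asIdeal) :
    u = fc.W₂₁r hθ h3 hR hpr ∨ u = fc.W₂₂r hθ h3 hR hpr := by
  rcases fc.qcover₂_of_reg hθ h3 hR hpr u.asIdeal u.isPrime hu with h | h
  · exact Or.inl (HeightOneSpectrum.ext h)
  · exact Or.inr (HeightOneSpectrum.ext h)

end W

omit [NumberField K] in
/-- `q₂ ∉ u` for a prime `u ∋ q₁` (in particular `W₁₁r`, `W₁₂r`). -/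
theorem q₂_not_mem_of_q₁_mem_reg (hR : fc.checkReg = true) (hpr : fc.primeList.Forall Nat.Prime)
    (u : HeightOneSpectrum (𝓞 K)) (hu : ((fc.q₁ : ℕ) : 𝓞 K) ∈ u.asIdeal) : ((fc.q₂ : ℕ) : 𝓞 K) ∉ u.asIdeal :=
  fc.not_mem_of_mem_q₁_reg hR hpr u.isPrime hu

omit [NumberField K] in
/-- `q₁ ∉ u` for a prime `u ∋ q₂` (in particular `W₂₁r`, `W₂₂r`). -/
theorem q₁_not_mem_of_q₂_mem_reg (hR : fc.checkReg = true) (hpr : fc.primeList.Forall Nat.Prime)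
    (u : HeightOneSpectrum (𝓞 K)) (hu : ((fc.q₂ : ℕ) : 𝓞 K) ∈ u.asIdeal) : ((fc.q₁ : ℕ) : 𝓞 K) ∉ u.asIdeal :=
  fun h₁ => fc.not_mem_of_mem_q₁_reg hR hpr u.isPrime h₁ hu

/-! ### The prime of a certified registry code -/

/-- The height-one prime `idealOf C` of a code certified present in the registry (junk `W₁₁r` otherwise). -/
def codePrimeR (hθ : aeval θ (MonicCubic.poly fc.a fc.b fc.c) = 0) (h3 : finrank ℚ K = 3)
    (hR : fc.checkReg = true) (hpr : fc.primeList.Forall Nat.Prime) (C : PCode) : HeightOneSpectrum (𝓞 K) :=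
  if h : (fc.primes.any fun e => e.p == C.1) = true ∧ C ∈ (fc.row C.1).codes then
    primeOfCode (fc.irreducible_of_reg hR) hθ h3 (e := fc.row C.1) (fc.prime_of_mem hpr (row_mem h.1).1)
      (fc.row_check_of_mem_reg hR (row_mem h.1).1).1 h.2
  else fc.W₁₁r hθ h3 hR hpr

/-- A certified code prime is presented by its code. [folklore] -/
theorem codePrimeR_asIdeal {fc : ClFieldCertQ2} (hθ : aeval θ (MonicCubic.poly fc.a fc.b fc.c) = 0) (h3 : finrank ℚ K = 3)
    (hR : fc.checkReg = true) (hpr : fc.primeList.Forall Nat.Prime) {C : PCode}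
    (h₁ : (fc.primes.any fun e => e.p == C.1) = true) (h₂ : C ∈ (fc.row C.1).codes) :
    (codePrimeR hθ h3 hR hpr C).asIdeal = idealOf hθ C := by
  rw [codePrimeR, dif_pos ⟨h₁, h₂⟩]
  rfl

end ClFieldCertQ2

/-! ## Generic valuation computations at the four auxiliary primes (registry core) -/

open ClFieldCertQ2

variable {fc}

/-- `|N(g)| = q^e · m`, `q ∤ m`, from `ordCheck` (any rational prime `q`). [folklore] -/
theorem natAbs_norm_of_ordCheck_reg₂ (hθ : aeval θ (MonicCubic.poly fc.a fc.b fc.c) = 0) (h3 : finrank ℚ K = 3)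
    (hR : fc.checkReg = true) {q : ℕ} {g : ℤ × ℤ × ℤ} {e : ℕ}
    (h : ordCheck q (normFormZ fc.a fc.b fc.c g.1 g.2.1 g.2.2).natAbs e = true) :
    (Algebra.norm ℤ (lin hθ g.1 g.2.1 g.2.2 : 𝓞 K)).natAbs =
        q ^ e * ((normFormZ fc.a fc.b fc.c g.1 g.2.1 g.2.2).natAbs / q ^ e) ∧
      ¬ q ∣ (normFormZ fc.a fc.b fc.c g.1 g.2.1 g.2.2).natAbs / q ^ e := by
  simp only [ordCheck, decide_eq_true_eq] at h
  rw [natAbs_norm_lin_coords (fc.irreducible_of_reg hR) hθ h3]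
  exact h

/-- `|N(q)| = q³ · 1` for a rational prime `q` on the power basis. -/
theorem natAbs_norm_natCast_reg₂ (hθ : aeval θ (MonicCubic.poly fc.a fc.b fc.c) = 0) (h3 : finrank ℚ K = 3)
    (hR : fc.checkReg = true) (q : ℕ) : (Algebra.norm ℤ ((q : ℕ) : 𝓞 K)).natAbs = q ^ 3 * 1 := by
  have e := natAbs_norm_lin_coords (fc.irreducible_of_reg hR) hθ h3 ((q : ℤ), 0, 0)
  simp only at e
  rw [lin_natCast hθ] at e
  rw [e]
  simp [normFormZ, Int.natAbs_pow]

section Logs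
variable (hθ : aeval θ (MonicCubic.poly fc.a fc.b fc.c) = 0) (h3 : finrank ℚ K = 3) (hR : fc.checkReg = true)
  (hpr : fc.primeList.Forall Nat.Prime)
include hθ h3 hR hpr

/-- `ord_{W₁₁r}(g) = e₁` from `g ∉ W₁₂r` and `|N g| = q₁^{e₁}·m`, `q₁ ∤ m`. [cite: Marcus2018, Ch. 3, Thm. 22] -/
theorem log_W₁₁r_of_not_mem {g : ℤ × ℤ × ℤ} {e₁ : ℕ}
    (hnm : (lin hθ g.1 g.2.1 g.2.2 : 𝓞 K) ∉ (fc.W₁₂r hθ h3 hR hpr).asIdeal)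
    (hord : ordCheck fc.q₁ (normFormZ fc.a fc.b fc.c g.1 g.2.1 g.2.2).natAbs e₁ = true) :
    WithZero.log ((fc.W₁₁r hθ h3 hR hpr).valuation K ((lin hθ g.1 g.2.1 g.2.2 : 𝓞 K) : K)) = -(e₁ : ℤ) := by
  have hq := fc.q₁_prime hpr
  obtain ⟨hN, hm⟩ := natAbs_norm_of_ordCheck_reg₂ hθ h3 hR hord
  refine log_valuation_eq_of_forall_not_mem hq ({fc.W₁₁r hθ h3 hR hpr, fc.W₁₂r hθ h3 hR hpr} : Finset _)
    (fun u hu => by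
      rcases eq_W₁₁r_or_W₁₂r hθ h3 hR hpr u hu with h | h <;> simp [h])
    (fun u => if u = fc.W₁₁r hθ h3 hR hpr then 1 else 2) (fun u hu => ?_) (by simp) (by simp) ?_ ?_ hm
  · simp only [Finset.mem_insert, Finset.mem_singleton] at hu
    rcases hu with rfl | rfl
    · simp [absNorm_W₁₁r]
    · rw [if_neg (W₁₁r_ne_W₁₂r hθ h3 hR hpr).symm]; exact absNorm_W₁₂r hθ h3 hR hpr
  · intro u hu hne
    simp only [Finset.mem_insert, Finset.mem_singleton] at hu
    rcases hu with rfl | rfl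
    · exact absurd rfl hne
    · exact hnm
  · simpa using hN

/-- `ord_{W₂₁r}(g) = e₂` from `g ∉ W₂₂r` and `|N g| = q₂^{e₂}·m`, `q₂ ∤ m`. [cite: Marcus2018, Ch. 3, Thm. 22] -/
theorem log_W₂₁r_of_not_mem {g : ℤ × ℤ × ℤ} {e₂ : ℕ}
    (hnm : (lin hθ g.1 g.2.1 g.2.2 : 𝓞 K) ∉ (fc.W₂₂r hθ h3 hR hpr).asIdeal)
    (hord : ordCheck fc.q₂ (normFormZ fc.a fc.b fc.c g.1 g.2.1 g.2.2).natAbs e₂ = true) :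
    WithZero.log ((fc.W₂₁r hθ h3 hR hpr).valuation K ((lin hθ g.1 g.2.1 g.2.2 : 𝓞 K) : K)) = -(e₂ : ℤ) := by
  have hq := fc.q₂_prime hpr
  obtain ⟨hN, hm⟩ := natAbs_norm_of_ordCheck_reg₂ hθ h3 hR hord
  refine log_valuation_eq_of_forall_not_mem hq ({fc.W₂₁r hθ h3 hR hpr, fc.W₂₂r hθ h3 hR hpr} : Finset _)
    (fun u hu => by
      rcases eq_W₂₁r_or_W₂₂r hθ h3 hR hpr u hu with h | h <;> simp [h])
    (fun u => if u = fc.W₂₁r hθ h3 hR hpr then 1 else 2) (fun u hu => ?_) (by simp) (by simp) ?_ ?_ hm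
  · simp only [Finset.mem_insert, Finset.mem_singleton] at hu
    rcases hu with rfl | rfl
    · simp [absNorm_W₂₁r]
    · rw [if_neg (W₂₁r_ne_W₂₂r hθ h3 hR hpr).symm]; exact absNorm_W₂₂r hθ h3 hR hpr
  · intro u hu hne
    simp only [Finset.mem_insert, Finset.mem_singleton] at hu
    rcases hu with rfl | rfl
    · exact absurd rfl hne
    · exact hnm
  · simpa using hN

/-- `ord_{W₁₁r}(q₁) = ord_{W₁₂r}(q₁) = 1`. -/
theorem log_q₁r :
    WithZero.log ((fc.W₁₁r hθ h3 hR hpr).valuation K ((((fc.q₁ : ℕ) : 𝓞 K) : 𝓞 K) : K)) = -1 ∧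
      WithZero.log ((fc.W₁₂r hθ h3 hR hpr).valuation K ((((fc.q₁ : ℕ) : 𝓞 K) : 𝓞 K) : K)) = -1 :=
  log_valuation_eq_neg_one_of_one_two (fc.q₁_prime hpr) (W₁₁r_ne_W₁₂r hθ h3 hR hpr)
    (eq_W₁₁r_or_W₁₂r hθ h3 hR hpr) (absNorm_W₁₁r hθ h3 hR hpr) (absNorm_W₁₂r hθ h3 hR hpr)
    (q₁_mem_W₁₁r hθ h3 hR hpr) (q₁_mem_W₁₂r hθ h3 hR hpr) (natAbs_norm_natCast_reg₂ hθ h3 hR fc.q₁)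
    (fun hd => (fc.q₁_prime hpr).one_lt.ne' (Nat.dvd_one.mp hd))

/-- `ord_{W₂₁r}(q₂) = ord_{W₂₂r}(q₂) = 1`. -/
theorem log_q₂r :
    WithZero.log ((fc.W₂₁r hθ h3 hR hpr).valuation K ((((fc.q₂ : ℕ) : 𝓞 K) : 𝓞 K) : K)) = -1 ∧
      WithZero.log ((fc.W₂₂r hθ h3 hR hpr).valuation K ((((fc.q₂ : ℕ) : 𝓞 K) : 𝓞 K) : K)) = -1 :=
  log_valuation_eq_neg_one_of_one_two (fc.q₂_prime hpr) (W₂₁r_ne_W₂₂r hθ h3 hR hpr)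
    (eq_W₂₁r_or_W₂₂r hθ h3 hR hpr) (absNorm_W₂₁r hθ h3 hR hpr) (absNorm_W₂₂r hθ h3 hR hpr)
    (q₂_mem_W₂₁r hθ h3 hR hpr) (q₂_mem_W₂₂r hθ h3 hR hpr) (natAbs_norm_natCast_reg₂ hθ h3 hR fc.q₂)
    (fun hd => (fc.q₂_prime hpr).one_lt.ne' (Nat.dvd_one.mp hd))

end Logs

end Summit.BirchSwinnertonDyer.BirchSwinnertonDyer.Rank2Observatory.TwoDescCl
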